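import Summits.Ventures.Crystal3D.Bulk.CapBoxSproc
import Summits.Ventures.Crystal3D.Bulk.CapX2Poly3
import Summits.Ventures.Crystal3D.Bulk.CapX2DataW06225X2
import HarnessLib

/-!
# X2 certificate `w6225_d14_dX14_u06225` (`CapX2.certW06225`): compiled check (II), sub-box `u ∈ [(-249 / 400),(19 / 100)]`, `v ∈ [(3 / 5),1]`, `t ∈ [(-1 / 4),(1 / 2)]`

Venture `Crystal3D` (cell `pub-crystal3d`, phase 2; seat p1 in seat typer-bulk's file pattern and naming, so that
typer-bulk's assembly `CapX2BoxW06225.lean` composes these cells unchanged). One of the Boolean evaluations behind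
`CapX2.noHole_06225`: the S-procedure tensor-Bernstein check `Bern.checkPos3S` (`CapBoxSproc.lean`, seat typer-bulk;
soundness `Bern.nonneg_of_checkPos3S` on the standard axioms) of the negated, padded (II) tensor `-(P+λ)` of the
level `u₀ = -249/400` certificate (seat idea-2's `cert_w6225_d14_dX14_u06225`, transcribed by p1 as `CapX2.certW06225`;
tensor `CapX2.pairPolyZ`, multidegree `(14,14,28)`, padded to degree `28`) on that sub-box of
`[-249/400,1]² × [-1,1/2]` (3 × 3 grid on `(u,v)`, the `u ≤ v` half by `CapX2.ineqII_of_half`, two `t`-halves),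
evaluated by `native_decide` (compiled code trusted — the class of the tree's `KissingSearch` parts). One compiled
search per file keeps each gate elaboration under its wall (this cell pattern measured: the cell holding the (II)
maximiser runs in ≈ 7 min). HONEST FRAMING: a computation; its meaning is given by `Bern.nonneg_of_checkPos3S`;
nothing here is unconditional about GAP(1.26).
-/

namespace Summit.Ventures.Crystal3D.CapX2

/-- (II), sub-box `u ∈ [(-249 / 400),(19 / 100)]`, `v ∈ [(3 / 5),1]`, `t ∈ [(-1 / 4),(1 / 2)]`: the check evaluates to `true`. [folklore] -/
theorem checkII_13hi_W06225 :
    CapCut.Bern.checkPos3S (CapCut.Bern.pad3 28 (scale3 (-1) (pairPolyZ certW06225 lamW06225))) 28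
      (-249 / 400) (19 / 100) (3 / 5) 1 (-1 / 4) (1 / 2) 80 40 64 = true := by
  native_decide

end Summit.Ventures.Crystal3D.CapX2
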